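import Summits.BirchSwinnertonDyer.BirchSwinnertonDyer.Theorems.AdditiveBranchIMCTwistFieldDecomposition
import HarnessLib

/-!
# Crux `GordTwoRankZeroOffCaseOne` (route `AdditiveBranchIMC`, item 19357), lane k1-c2x: the control at the
# additive prime, `Λ`-adically — `char_Λ X(V/K·ℚ_∞) = char_Λ X(V/ℚ_∞) · char_Λ X(E/ℚ_∞)`
# (sequel of `AdditiveBranchIMCTwistFieldDecomposition`)

Cell `bsd-addord`, seat `bsd-addord-k1-c2x` (second prover lane on item 19357; director-bsd 2026-08-27:
«Skinner–Urban over the quadratic twist field `K = ℚ(√p*)` with explicit control at the additive prime»).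
HONEST FRAMING: infrastructure about the TREE'S OWN objects — no curve is asserted to satisfy anything, no
named fact is minted or consumed, nothing is booked; BSD is not proved by any of this. From the short exact
sequence `0 → X(E/ℚ_∞) → X(V/K·ℚ_∞) → X(V/ℚ_∞) → 0` of `Λ`-modules of the prequel (there in the form: two
`Λ`-linear surjections with joint kernel `0`, the second onto on the kernel of the first) this file derives:

* `exists_surjective_linearEquiv_ker` — a `Λ`-linear surjection `π : X(V/K·ℚ_∞) ↠ X(V/ℚ_∞)` with
  `ker π ≃ₗ X(E/ℚ_∞)`;
* `moduleFinite_towerDual`, `isTorsion_towerDual_iff` — `X(V/K·ℚ_∞)` is finitely generated, resp.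
  `Λ`-torsion, exactly when `X(V/ℚ_∞)` and `X(E/ℚ_∞)` are;
* **`charIdeal_towerDual_eq_mul`** — `char_Λ X(V/K·ℚ_∞) = char_Λ X(V/ℚ_∞) · char_Λ X(E/ℚ_∞)` for
  finitely generated torsion factors (the tree's multiplicativity `Module.charIdeal_eq_mul_of_exact`,
  Bourbaki AC VII §4.5 Prop. 10, and invariance under `≃ₗ`);
* `nonempty_towerSelmerDualData` — non-vacuity (the tower datum exists, `κ` onto on `Gal(ℚ̄/K)`).

For `K = ℚ(√p*)` and `V = E♭` the semistable twist of an additive pair `(E, p)` this says: the ALGEBRAIC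
side of the Iwasawa main conjecture for `V` over the cyclotomic `ℤ_p`-extension of the twist field `K` is
EXACTLY the product of the algebraic sides for `V/ℚ_∞` (trivial branch) and for `E/ℚ_∞` (the
`ω^{(p−1)/2}`-branch, by additive-p1's [C]); the sequel `AdditiveBranchIMCTwistFieldReduction` pairs it
with Artin formalism on the analytic side. Nothing about either factor is asserted.

References: R. Greenberg, LNM 1716 (1999) §1 p. 60, §5 p. 143 [GreenbergLNM1716]; N. Bourbaki,
*Algèbre commutative* VII §4.5 Prop. 10; L. Washington, *Cyclotomic Fields* §13.2.
-/

set_option autoImplicit false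
set_option linter.dupNamespace false

noncomputable section

open scoped Classical

open Literature.NumberTheory.EllipticCurves Literature.NumberTheory.GaloisRepresentations WeierstrassCurve

namespace Summit.BirchSwinnertonDyer.BirchSwinnertonDyer.Theorems.AdditiveBranchIMCTwistField

open Summit.BirchSwinnertonDyer.Rank1Residual.Additive (TowerSelmerDualData towerSelmerDualData)

/-! ## §4 The product formula `char_Λ X(V/K·ℚ_∞) = char_Λ X(V/ℚ_∞) · char_Λ X(E/ℚ_∞)` -/

section CharIdeal

variable (V : WeierstrassCurve ℚ) [V.IsElliptic] (K : Type) [Field K] [NumberField K]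
  (h2 : Module.finrank ℚ K = 2) {θ : K} {c : ℚ} (hθ : θ ∉ Set.range (algebraMap ℚ K))
  (hc : θ ^ 2 = algebraMap ℚ K c) (p : ℕ) [Fact p.Prime] (κ : ZpExtension ℚ p)
  [(galRange (K := ℚ) K).Normal] [(V.quadraticTwist c).IsElliptic]
  {W : WeierstrassCurve ℚ} {C : VariableChange ℚ} (hCW : C • V.quadraticTwist c = W)
  {γ : Field.absoluteGaloisGroup ℚ} (hγ : κ.IsTopGenerator γ) (hγK : γ ∈ galRange (K := ℚ) K)

include h2 hθ hc hCW hγ hγK in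
/-- **The short exact sequence `0 → X(E/ℚ_∞) → X(V/K·ℚ_∞) → X(V/ℚ_∞) → 0` of `Λ`-modules**, packaged:
a `Λ`-linear surjection `π : X(V/K·ℚ_∞) ↠ X(V/ℚ_∞)` together with a `Λ`-linear ISOMORPHISM
`ker π ≃ X(E/ℚ_∞)` (any three dual data at a common generator `γ ∈ Gal(ℚ̄/K)`, `p` odd).
[cite: GreenbergLNM1716, §1 p. 60, §5 p. 143] -/
theorem exists_surjective_linearEquiv_ker (hp2 : p ≠ 2) (D_K : TowerSelmerDualData V κ K γ)
    (D_V : V.SelmerDualData κ γ) (D : W.SelmerDualData κ γ) :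
    ∃ π : D_K.X →ₗ[IwasawaAlgebra p] D_V.X, Function.Surjective π ∧
      Nonempty (LinearMap.ker π ≃ₗ[IwasawaAlgebra p] D.X) := by
  obtain ⟨π₁, π₂, hπ₁, -, hker, hlift⟩ :=
    exists_dual_projections V K h2 hθ hc p κ hCW hγ hγK hp2 D_K D_V D
  refine ⟨π₁, hπ₁, ⟨LinearEquiv.ofBijective (π₂.comp (LinearMap.ker π₁).subtype) ⟨?_, ?_⟩⟩⟩
  · intro x y hxy
    rw [← sub_eq_zero] at hxy ⊢
    have h0 : (x - y : D_K.X) = 0 := by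
      refine hker _ ?_ ?_
      · rw [map_sub, (LinearMap.mem_ker).mp x.2, (LinearMap.mem_ker).mp y.2, sub_zero]
      · rw [map_sub]
        exact hxy
    exact Subtype.ext h0
  · intro z
    obtain ⟨x, hx₁, hx₂⟩ := hlift z
    exact ⟨⟨x, LinearMap.mem_ker.mpr hx₁⟩, hx₂⟩

include h2 hθ hc hCW hγ hγK in
/-- **`X(V/K·ℚ_∞)` is finitely generated over `Λ` when `X(V/ℚ_∞)` and `X(E/ℚ_∞)` are** (extension
of finitely generated modules). With the tree's `SelmerDualData.module_finite_of_isCyclotomic` both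
hypotheses hold for the cyclotomic `κ` and every elliptic `V`, `W`. [cite: GreenbergLNM1716, §1 p. 60] -/
theorem moduleFinite_towerDual (hp2 : p ≠ 2) (D_K : TowerSelmerDualData V κ K γ)
    (D_V : V.SelmerDualData κ γ) (D : W.SelmerDualData κ γ) [Module.Finite (IwasawaAlgebra p) D_V.X]
    [Module.Finite (IwasawaAlgebra p) D.X] : Module.Finite (IwasawaAlgebra p) D_K.X := by
  obtain ⟨π, hπ, ⟨e⟩⟩ := exists_surjective_linearEquiv_ker V K h2 hθ hc p κ hCW hγ hγK hp2 D_K D_V D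
  haveI : Module.Finite (IwasawaAlgebra p) (LinearMap.ker π) := Module.Finite.equiv e.symm
  exact Module.Finite.of_exact (LinearMap.exact_subtype_ker_map π) hπ

include h2 hθ hc hCW hγ hγK in
/-- **`X(V/K·ℚ_∞)` is `Λ`-torsion iff `X(V/ℚ_∞)` and `X(E/ℚ_∞)` are.** [cite: GreenbergLNM1716, §1 p. 60] -/
theorem isTorsion_towerDual_iff (hp2 : p ≠ 2) (D_K : TowerSelmerDualData V κ K γ)
    (D_V : V.SelmerDualData κ γ) (D : W.SelmerDualData κ γ) :
    Module.IsTorsion (IwasawaAlgebra p) D_K.X ↔ D_V.IsTorsion ∧ D.IsTorsion := by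
  obtain ⟨π, hπ, ⟨e⟩⟩ := exists_surjective_linearEquiv_ker V K h2 hθ hc p κ hCW hγ hγK hp2 D_K D_V D
  refine ⟨fun hK ↦ ⟨fun y ↦ ?_, fun z ↦ ?_⟩, fun ⟨hV, hE⟩ x ↦ ?_⟩
  · obtain ⟨x, rfl⟩ := hπ y
    obtain ⟨a, ha⟩ := @hK x
    refine ⟨a, ?_⟩
    rw [Submonoid.smul_def] at ha ⊢
    rw [← map_smul, ha, map_zero]
  · obtain ⟨a, ha⟩ := @hK ((e.symm z : LinearMap.ker π) : D_K.X)
    refine ⟨a, ?_⟩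
    rw [Submonoid.smul_def] at ha ⊢
    have h0 : (a : IwasawaAlgebra p) • e.symm z = 0 :=
      Subtype.ext (by rw [Submodule.coe_smul, ha, Submodule.coe_zero])
    rw [← e.apply_symm_apply z, ← map_smul, h0, map_zero]
  · obtain ⟨a, ha⟩ := @hV (π x)
    rw [Submonoid.smul_def] at ha
    have hmem : (a : IwasawaAlgebra p) • x ∈ LinearMap.ker π := by
      rw [LinearMap.mem_ker, map_smul, ha]
    obtain ⟨b, hb⟩ := @hE (e ⟨_, hmem⟩)
    rw [Submonoid.smul_def] at hb
    have h0 : (b : IwasawaAlgebra p) • (⟨_, hmem⟩ : LinearMap.ker π) = 0 :=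
      e.injective (by rw [map_smul, hb, map_zero])
    refine ⟨b * a, ?_⟩
    rw [Submonoid.smul_def, Submonoid.coe_mul, mul_smul]
    exact congrArg Subtype.val h0

include h2 hθ hc hCW hγ hγK in
/-- **THE CONTROL AT THE ADDITIVE PRIME, `Λ`-adically: `char_Λ X(V/K·ℚ_∞) = char_Λ X(V/ℚ_∞) · char_Λ X(E/ℚ_∞)`.**
For an elliptic curve `V/ℚ`, a quadratic field `K = ℚ(θ)`, `θ² = c`, any model `W` of
`E = V ⊗ χ_K` (`C • V^{(c)} = W`), an odd prime `p`, a `ℤ_p`-extension datum `κ` with topological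
generator `γ ∈ Gal(ℚ̄/K)`, and Pontryagin-dual data `D_K`, `D_V`, `D` of `Sel_{p^∞}(V/K·ℚ_∞)`,
`Sel_{p^∞}(V/ℚ_∞)`, `Sel_{p^∞}(E/ℚ_∞)` with `X(V/ℚ_∞)`, `X(E/ℚ_∞)` finitely generated and `Λ`-torsion:
the characteristic ideals multiply (the tree's multiplicativity `Module.charIdeal_eq_mul_of_exact` on the
short exact sequence of `exists_surjective_linearEquiv_ker`). For `K = ℚ(√p*)`, `V = E♭` the good
ordinary (or multiplicative) twist of an additive `(E, p)`: the Iwasawa main conjecture for `V` over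
`K_∞^{cyc}` is, on the algebraic side, EXACTLY the product of the main conjecture for `V` over `ℚ_∞` and the
`ω^{(p−1)/2}`-branch statement for `E` — nothing about either factor is asserted here.
[cite: GreenbergLNM1716, §1 p. 60, §5 p. 143] -/
theorem charIdeal_towerDual_eq_mul (hp2 : p ≠ 2) (D_K : TowerSelmerDualData V κ K γ)
    (D_V : V.SelmerDualData κ γ) (D : W.SelmerDualData κ γ) [Module.Finite (IwasawaAlgebra p) D_V.X]
    [Module.Finite (IwasawaAlgebra p) D.X] (hV : D_V.IsTorsion) (hE : D.IsTorsion) :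
    Literature.NumberTheory.EllipticCurves.Module.charIdeal (IwasawaAlgebra p) D_K.X =
      D_V.charIdeal * D.charIdeal := by
  haveI := moduleFinite_towerDual V K h2 hθ hc p κ hCW hγ hγK hp2 D_K D_V D
  have hK : Module.IsTorsion (IwasawaAlgebra p) D_K.X :=
    (isTorsion_towerDual_iff V K h2 hθ hc p κ hCW hγ hγK hp2 D_K D_V D).mpr ⟨hV, hE⟩
  obtain ⟨π, hπ, ⟨e⟩⟩ := exists_surjective_linearEquiv_ker V K h2 hθ hc p κ hCW hγ hγK hp2 D_K D_V D
  rw [Literature.NumberTheory.EllipticCurves.Module.charIdeal_eq_mul_of_exact hK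
    (LinearMap.ker π).subtype π Subtype.val_injective hπ (LinearMap.exact_subtype_ker_map π),
    Literature.NumberTheory.EllipticCurves.Module.charIdeal_eq_of_linearEquiv e, mul_comm]
  rfl

omit [V.IsElliptic] in
include h2 hγ hγK in
/-- **Non-vacuity**: for `γ ∈ Gal(ℚ̄/K)` a topological generator (`p` odd) the classical tower datum
`X(V/K·ℚ_∞)` EXISTS (cell `bsd-potss`'s `towerSelmerDualData`, `κ` onto on `Gal(ℚ̄/K)`), as do the data
`X(V/ℚ_∞)`, `X(E/ℚ_∞)` (`selmerDualData`); so the `∀ D_K` statements above and in the sequel are about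
honest objects. [cite: GreenbergLNM1716, §1 p. 60] -/
theorem nonempty_towerSelmerDualData (hp2 : p ≠ 2) :
    Nonempty (TowerSelmerDualData V κ K γ) :=
  ⟨towerSelmerDualData V κ K (kappa_surjOn_galRange K h2 p κ hp2) hγ hγK⟩

end CharIdeal

end Summit.BirchSwinnertonDyer.BirchSwinnertonDyer.Theorems.AdditiveBranchIMCTwistField

end
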